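import Literature.RingTheory.Flat.FlatLimitLocal
import Literature.RingTheory.Flat.FlatLocus
import Mathlib.RingTheory.Flat.Localization
import Mathlib.RingTheory.Localization.BaseChange
import Mathlib.RingTheory.Spectrum.Prime.Topology
import HarnessLib

/-!
# Flatness descends to a finite level of the absolute Noetherian approximation (Stacks 02JO (1))

Let `A` be a ring, `f₁, …, f_m ∈ A[x₁, …, x_n]` and `A[x]/(f) = colim_T P_T` the absolute
Noetherian approximation (`Literature.RingTheory.Flat.NoetherianApproximation`). If `A[x]/(f)`
is flat over `A`, then some `P_T` is flat over `T` (The Stacks Project, Tag 02JO (1)).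

## Main results

* `Idx.flat_localization_of_le` (**monotonicity**): for `T ⊆ T′` and a prime `Q′` of `P_{T′}`
  over the prime `Q` of `P_T`, if `(P_T)_Q` is flat over `T` then `(P_{T′})_{Q′}` is flat over
  `T′`.
* `Idx.exists_flat_level` (**Stacks 02JO (1)**): if `A[x]/(f)` is flat over `A` then `P_T` is flat
  over `T` for some `T`.

## References

* [The Stacks Project, Tag 02JO][StacksProject]
-/

universe u

open TensorProduct

noncomputable section

namespace Literature.RingTheory.Flat

namespace Idx

variable {A : Type u} [CommRing A] {n m : ℕ} {f : Fin m → MvPolynomial (Fin n) A}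

/-! ### Monotonicity of flatness at primes along `T ⊆ T′` -/

section Mono

variable {lam mu : Idx f} [Algebra lam.T mu.T] [IsScalarTower lam.T mu.T A]

/-- The comparison map `P_T ⊗_T X → P_{T′} ⊗_{T′} X`, `q ⊗ x ↦ incl q ⊗ x`, for a `T′`-module `X`.
[folklore] -/
def betaMap (X : Type*) [AddCommGroup X] [Module mu.T X] [Module lam.T X]
    [IsScalarTower lam.T mu.T X] : lam.P ⊗[lam.T] X →ₗ[lam.T] mu.P ⊗[mu.T] X :=
  TensorProduct.lift
    (LinearMap.mk₂ lam.T (fun q x => (incl : lam.P →ₐ[lam.T] mu.P) q ⊗ₜ[mu.T] x)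
      (fun q₁ q₂ x => by rw [map_add, TensorProduct.add_tmul])
      (fun t q x => by rw [map_smul, TensorProduct.smul_tmul'])
      (fun q x₁ x₂ => by rw [TensorProduct.tmul_add])
      (fun t q x => by rw [← TensorProduct.smul_tmul, TensorProduct.smul_tmul']))

/-- `β (q ⊗ x) = incl q ⊗ x`. [folklore] -/
@[simp] theorem betaMap_tmul {X : Type*} [AddCommGroup X] [Module mu.T X] [Module lam.T X]
    [IsScalarTower lam.T mu.T X] (q : lam.P) (x : X) :
    betaMap (lam := lam) (mu := mu) X (q ⊗ₜ[lam.T] x) = (incl : lam.P →ₐ[lam.T] mu.P) q ⊗ₜ[mu.T] x := rfl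

/-- `β` is semilinear for `incl`. [folklore] -/
theorem betaMap_smul {X : Type*} [AddCommGroup X] [Module mu.T X] [Module lam.T X]
    [IsScalarTower lam.T mu.T X] (u : lam.P) (z : lam.P ⊗[lam.T] X) :
    betaMap (lam := lam) (mu := mu) X (u • z) = (incl : lam.P →ₐ[lam.T] mu.P) u • betaMap (lam := lam) (mu := mu) X z := by
  induction z using TensorProduct.induction_on with
  | zero => rw [smul_zero, map_zero, smul_zero]
  | add x y hx hy => rw [smul_add, map_add, map_add, hx, hy, smul_add]
  | tmul q x =>
    rw [TensorProduct.smul_tmul', betaMap_tmul, betaMap_tmul, TensorProduct.smul_tmul', smul_eq_mul,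
      smul_eq_mul, map_mul]

/-- `β` is natural in `X`. [folklore] -/
theorem betaMap_lTensor {X Y : Type*} [AddCommGroup X] [Module mu.T X] [Module lam.T X]
    [IsScalarTower lam.T mu.T X] [AddCommGroup Y] [Module mu.T Y] [Module lam.T Y]
    [IsScalarTower lam.T mu.T Y] (ι : X →ₗ[mu.T] Y) (z : lam.P ⊗[lam.T] X) :
    betaMap (lam := lam) (mu := mu) Y (LinearMap.lTensor lam.P (ι.restrictScalars lam.T) z) =
      LinearMap.lTensor mu.P ι (betaMap (lam := lam) (mu := mu) X z) := by
  induction z using TensorProduct.induction_on with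
  | zero => rw [map_zero, map_zero, map_zero, map_zero]
  | add x y hx hy => rw [map_add, map_add, hx, hy, map_add, map_add]
  | tmul q x => rw [LinearMap.lTensor_tmul, betaMap_tmul, betaMap_tmul, LinearMap.lTensor_tmul]; rfl

/-- **`β` is bijective** (`P_{T′} = T′ ⊗_T P_T`, so `P_{T′} ⊗_{T′} X = P_T ⊗_T X`). [folklore] -/
theorem betaMap_bijective (X : Type u) [AddCommGroup X] [Module mu.T X] [Module lam.T X]
    [IsScalarTower lam.T mu.T X] : Function.Bijective (betaMap (lam := lam) (mu := mu) X) := by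
  letI := algebraPP (lam := lam) (mu := mu)
  haveI := isScalarTower_T_P_P (lam := lam) (mu := mu)
  have hincl : IsBaseChange mu.T (incl : lam.P →ₐ[lam.T] mu.P).toLinearMap := by
    have h := (isPushout_incl (lam := lam) (mu := mu)).out
    have heq : (IsScalarTower.toAlgHom lam.T lam.P mu.P).toLinearMap =
        (incl : lam.P →ₐ[lam.T] mu.P).toLinearMap := LinearMap.ext fun _ => rfl
    rwa [heq] at h
  let e : mu.T ⊗[lam.T] lam.P ≃ₗ[mu.T] mu.P := hincl.equiv
  obtain ⟨Φ, hΦ⟩ := exists_baseChangeTensorAddEquiv lam.T mu.T lam.P X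
  let cX : mu.P ⊗[mu.T] X ≃ₗ[mu.T] (mu.T ⊗[lam.T] lam.P) ⊗[mu.T] X :=
    TensorProduct.congr e.symm (LinearEquiv.refl mu.T X)
  let ΦX : mu.P ⊗[mu.T] X ≃+ lam.P ⊗[lam.T] X := cX.toAddEquiv.trans Φ
  -- `Φ ∘ β = id`
  have hleft : ∀ z, ΦX (betaMap (lam := lam) (mu := mu) X z) = z := by
    intro z
    induction z using TensorProduct.induction_on with
    | zero => rw [map_zero, map_zero]
    | add x y hx hy => rw [map_add, map_add, hx, hy]
    | tmul q x =>
      rw [betaMap_tmul]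
      change Φ (cX ((incl : lam.P →ₐ[lam.T] mu.P) q ⊗ₜ[mu.T] x)) = q ⊗ₜ[lam.T] x
      have he : e.symm ((incl : lam.P →ₐ[lam.T] mu.P) q) = (1 : mu.T) ⊗ₜ[lam.T] q := by
        rw [LinearEquiv.symm_apply_eq, IsBaseChange.equiv_tmul, one_smul]
        rfl
      simp only [cX, TensorProduct.congr_tmul, LinearEquiv.refl_apply, he, hΦ, one_smul]
  have hβ : ⇑(betaMap (lam := lam) (mu := mu) X) = ⇑ΦX.symm :=
    funext fun z => ΦX.eq_symm_apply.mpr (hleft z)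
  rw [hβ]
  exact ΦX.symm.bijective

/-- **Monotonicity of flatness at primes** (The Stacks Project, Tag 02JO, proof: "the inverse
image of `U_λ` in `Spec S_μ` is contained in `U_μ`"): for `T ⊆ T′` and a prime `Q′` of `P_{T′}`
lying over the prime `Q` of `P_T`, if `(P_T)_Q` is flat over `T` then `(P_{T′})_{Q′}` is flat over
`T′`. Proof by the torsion criterion `injective_lTensor_iff_forall_exists_smul_eq_zero` at both
levels and the `incl`-semilinear bijection `P_T ⊗_T X ≅ P_{T′} ⊗_{T′} X`.
[cite: StacksProject, Tag 02JO (proof)] -/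
theorem flat_localization_of_le (Q : Ideal lam.P) [Q.IsPrime] (Q' : Ideal mu.P) [Q'.IsPrime]
    (hQ : Q'.comap (incl : lam.P →ₐ[lam.T] mu.P) = Q)
    (hflat : Module.Flat lam.T (Localization.AtPrime Q)) :
    Module.Flat mu.T (Localization.AtPrime Q') := by
  subst hQ
  -- the localization maps, as localized modules
  let gmu := (IsScalarTower.toAlgHom mu.P mu.P (Localization.AtPrime Q')).toLinearMap
  haveI : IsLocalizedModule Q'.primeCompl gmu := isLocalizedModule_iff_isLocalization.mpr inferInstance
  let glam := (IsScalarTower.toAlgHom lam.P lam.P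
    (Localization.AtPrime (Q'.comap (incl : lam.P →ₐ[lam.T] mu.P)))).toLinearMap
  haveI : IsLocalizedModule (Q'.comap (incl : lam.P →ₐ[lam.T] mu.P)).primeCompl glam :=
    isLocalizedModule_iff_isLocalization.mpr inferInstance
  rw [Module.Flat.iff_lTensor_injective']
  intro I'
  rw [injective_lTensor_iff_forall_exists_smul_eq_zero Q'.primeCompl gmu (Submodule.subtype I')]
  intro k' hk'
  -- level `T`
  let ι : ↥I' →ₗ[lam.T] mu.T := (Submodule.subtype I').restrictScalars lam.T
  have hinj : Function.Injective (LinearMap.lTensor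
      (Localization.AtPrime (Q'.comap (incl : lam.P →ₐ[lam.T] mu.P))) ι) :=
    Module.Flat.lTensor_preserves_injective_linearMap ι Subtype.val_injective
  rw [injective_lTensor_iff_forall_exists_smul_eq_zero
    (Q'.comap (incl : lam.P →ₐ[lam.T] mu.P)).primeCompl glam ι] at hinj
  -- transport `k′` to level `T`
  obtain ⟨k, rfl⟩ := (betaMap_bijective (lam := lam) (mu := mu) ↥I').2 k'
  have hk : k ∈ LinearMap.ker (LinearMap.lTensor lam.P ι) := by
    rw [LinearMap.mem_ker]
    apply (betaMap_bijective (lam := lam) (mu := mu) mu.T).1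
    rw [betaMap_lTensor, map_zero]
    exact hk'
  obtain ⟨u, hu⟩ := hinj k hk
  refine ⟨⟨(incl : lam.P →ₐ[lam.T] mu.P) u, fun h => u.2 (Ideal.mem_comap.mpr h)⟩, ?_⟩
  change ((incl : lam.P →ₐ[lam.T] mu.P) u) • betaMap (lam := lam) (mu := mu) ↥I' k = 0
  rw [← betaMap_smul, hu, map_zero]

/-- Functoriality of `incl` for `T ⊆ T′ ⊆ T″`. [folklore] -/
theorem incl_incl {nu : Idx f} [Algebra mu.T nu.T] [IsScalarTower mu.T nu.T A]
    [Algebra lam.T nu.T] [IsScalarTower lam.T nu.T A] [IsScalarTower lam.T mu.T nu.T]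
    (y : lam.P) :
    (incl : mu.P →ₐ[mu.T] nu.P) ((incl : lam.P →ₐ[lam.T] mu.P) y) =
      (incl : lam.P →ₐ[lam.T] nu.P) y := by
  obtain ⟨p, rfl⟩ := lam.mkP_surjective y
  rw [incl_mkP, incl_mkP, incl_mkP, MvPolynomial.map_map, ← IsScalarTower.algebraMap_eq]

/-- `𝔮_{T′} ∩ P_T = 𝔮_T`. [folklore] -/
theorem comap_incl_qT (𝔮 : Ideal (Pinf f)) :
    (mu.qT 𝔮).comap (incl : lam.P →ₐ[lam.T] mu.P) = lam.qT 𝔮 := by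
  ext y
  simp only [qT, Ideal.mem_comap]
  exact Iff.of_eq (congrArg (· ∈ 𝔮) (toPinf_incl (lam := lam) (mu := mu) y))

end Mono

/-! ### Flatness of localizations: `LocalizedModule` versus `Localization.AtPrime` -/

omit [CommRing A] in
/-- For an `R`-algebra `S` and a prime `Q` of `S`, flatness over `R` of the localized module
`S_Q` does not depend on the model. [folklore] -/
theorem flat_localizedModule_iff_flat_localization {R S : Type*} [CommRing R] [CommRing S]
    [Algebra R S] (Q : Ideal S) [Q.IsPrime] :
    Module.Flat R (LocalizedModule Q.primeCompl S) ↔ Module.Flat R (Localization.AtPrime Q) := by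
  let g := (IsScalarTower.toAlgHom S S (Localization.AtPrime Q)).toLinearMap
  haveI : IsLocalizedModule Q.primeCompl g := isLocalizedModule_iff_isLocalization.mpr inferInstance
  let e : LocalizedModule Q.primeCompl S ≃ₗ[R] Localization.AtPrime Q :=
    (IsLocalizedModule.iso Q.primeCompl g).restrictScalars R
  exact ⟨fun _ => Module.Flat.of_linearEquiv e.symm, fun _ => Module.Flat.of_linearEquiv e⟩

/-! ### Lifting finitely many elements to a common level -/

/-- Finitely many elements of `A[x]/(f)` come from a common level `T′ ≥ T`. [folklore] -/
theorem exists_level_forall_toPinf_eq (lam : Idx f) {N : ℕ} (c : Fin N → Pinf f) :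
    ∃ (mu : Idx f) (_ : lam ≤ mu) (c' : Fin N → mu.P), ∀ i, mu.toPinf (c' i) = c i := by
  induction N with
  | zero => exact ⟨lam, le_rfl, Fin.elim0, fun i => Fin.elim0 i⟩
  | succ N ih =>
    obtain ⟨mu, hmu, c', hc'⟩ := ih (fun i => c (Fin.castSucc i))
    obtain ⟨nu, hnu, y, hy⟩ := exists_toPinf_eq mu (c (Fin.last N))
    letI := algebraOfLE hnu
    haveI := isScalarTower_of_le hnu
    refine ⟨nu, hmu.trans hnu, Fin.lastCases y (fun i => (incl : mu.P →ₐ[mu.T] nu.P) (c' i)),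
      fun i => ?_⟩
    refine Fin.lastCases ?_ (fun j => ?_) i
    · simp only [Fin.lastCases_last]; exact hy
    · simp only [Fin.lastCases_castSucc, toPinf_incl]; exact hc' j

/-! ### Stacks 02JO (1) -/

/-- **Flatness descends to a finite level** (The Stacks Project, Tag 02JO (1), for the system
`P_T`, `T` ranging over the absolute Noetherian approximation): if `A[x]/(f)` is flat over `A`,
then `P_T` is flat over `T` for some `T`. Proof: by `exists_flat_atPrime` (Tag 00R6) every prime
of `A[x]/(f)` lies over the open (Tag 00RC, `isOpen_setOf_flat_localizedModule`) flat locus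
`U_T ⊆ Spec P_T` for `T` large; by quasi-compactness and monotonicity
(`flat_localization_of_le`) one `T₁` works for all primes of `A[x]/(f)`; writing the closed
complement of `U_{T₁}` as `V(J)`, `J` generates the unit ideal of `A[x]/(f)`, hence of `P_{T₃}`
for some `T₃ ≥ T₁`, so every prime of `P_{T₃}` lies over `U_{T₁}` and `P_{T₃}` is flat over
`T₃` (flatness is local). [cite: StacksProject, Tag 02JO] -/
theorem exists_flat_level [Module.Flat A (Pinf f)] : ∃ mu : Idx f, Module.Flat mu.T mu.P := by
  classical
  let lam₀ := Idx.init f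
  -- Step 1: every prime of `A[x]/(f)` is flat at the level `λ₀.adjoin (W 𝔮)`
  have h1 : ∀ 𝔮 : PrimeSpectrum (Pinf f), ∃ W : Finset A,
      ∀ (mu : Idx f) [Algebra lam₀.T mu.T] [IsScalarTower lam₀.T mu.T A],
        (↑W ⊆ (mu.T : Set A)) → Module.Flat mu.T (Localization.AtPrime (mu.qT 𝔮.asIdeal)) :=
    fun 𝔮 => exists_flat_atPrime 𝔮.asIdeal lam₀
  choose W hW using h1
  let lev : PrimeSpectrum (Pinf f) → Idx f := fun 𝔮 => lam₀.adjoin (W 𝔮)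
  -- the flat loci and their preimages
  let U : ∀ nu : Idx f, Set (PrimeSpectrum nu.P) := fun nu =>
    {Q | Module.Flat nu.T (Localization.AtPrime Q.asIdeal)}
  have hUopen : ∀ nu : Idx f, IsOpen (U nu) := fun nu => by
    haveI := nu.isNoetherianRing
    haveI : Algebra.FiniteType nu.T nu.P := Idx.finiteType_P nu
    have h := isOpen_setOf_flat_localizedModule (A := nu.T) (B := nu.P) nu.P
    have heq : {Q : PrimeSpectrum nu.P | Module.Flat nu.T (LocalizedModule Q.asIdeal.primeCompl nu.P)} =
        U nu := Set.ext fun Q => flat_localizedModule_iff_flat_localization Q.asIdeal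
    rwa [heq] at h
  let O : PrimeSpectrum (Pinf f) → Set (PrimeSpectrum (Pinf f)) := fun 𝔮 =>
    PrimeSpectrum.comap ((lev 𝔮).toPinf : (lev 𝔮).P →+* Pinf f) ⁻¹' U (lev 𝔮)
  have hOopen : ∀ 𝔮, IsOpen (O 𝔮) := fun 𝔮 =>
    (hUopen (lev 𝔮)).preimage (PrimeSpectrum.continuous_comap _)
  have hmemO : ∀ 𝔮 𝔮' : PrimeSpectrum (Pinf f), 𝔮' ∈ O 𝔮 ↔
      Module.Flat (lev 𝔮).T (Localization.AtPrime ((lev 𝔮).qT 𝔮'.asIdeal)) := fun 𝔮 𝔮' => Iff.rfl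
  have hOself : ∀ 𝔮, 𝔮 ∈ O 𝔮 := fun 𝔮 => by
    rw [hmemO]
    letI := algebraOfLE (lam₀.le_adjoin (W 𝔮))
    haveI := isScalarTower_of_le (lam₀.le_adjoin (W 𝔮))
    exact hW 𝔮 (lev 𝔮) (lam₀.subset_adjoin (W 𝔮))
  -- Step 2: a finite subcover and a common level `μ₁`
  obtain ⟨t, ht⟩ := isCompact_univ.elim_finite_subcover O hOopen
    (fun 𝔮 _ => Set.mem_iUnion.mpr ⟨𝔮, hOself 𝔮⟩)
  let mu₁ : Idx f := lam₀.adjoin (t.biUnion W)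
  have hlev : ∀ 𝔮 ∈ t, lev 𝔮 ≤ mu₁ := fun 𝔮 h𝔮 => by
    change lam₀.T ⊔ Algebra.adjoin ℤ ↑(W 𝔮) ≤ lam₀.T ⊔ Algebra.adjoin ℤ ↑(t.biUnion W)
    exact sup_le_sup_left (Algebra.adjoin_mono (Finset.coe_subset.mpr
      (Finset.subset_biUnion_of_mem W h𝔮))) _
  -- Step 3: every prime of `A[x]/(f)` is flat at level `μ₁`
  have hC : ∀ 𝔮' : PrimeSpectrum (Pinf f),
      Module.Flat mu₁.T (Localization.AtPrime (mu₁.qT 𝔮'.asIdeal)) := by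
    intro 𝔮'
    obtain ⟨𝔮, h𝔮t, h𝔮'⟩ : ∃ 𝔮 ∈ t, 𝔮' ∈ O 𝔮 := by
      simpa only [Set.mem_iUnion, exists_prop] using ht (Set.mem_univ 𝔮')
    rw [hmemO] at h𝔮'
    letI := algebraOfLE (hlev 𝔮 h𝔮t)
    haveI := isScalarTower_of_le (hlev 𝔮 h𝔮t)
    exact flat_localization_of_le ((lev 𝔮).qT 𝔮'.asIdeal) (mu₁.qT 𝔮'.asIdeal)
      (comap_incl_qT 𝔮'.asIdeal) h𝔮'
  -- Step 4: the closed complement `V(J)` of `U_{μ₁}` has empty preimage, so `J A[x]/(f) = (1)`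
  let J : Ideal mu₁.P := PrimeSpectrum.vanishingIdeal (U mu₁)ᶜ
  have hZ : PrimeSpectrum.zeroLocus (J : Set mu₁.P) = (U mu₁)ᶜ := by
    rw [PrimeSpectrum.zeroLocus_vanishingIdeal_eq_closure, (hUopen mu₁).isClosed_compl.closure_eq]
  have hJtop : J.map (mu₁.toPinf : mu₁.P →+* Pinf f) = ⊤ := by
    by_contra hne
    obtain ⟨𝔪, h𝔪, hJ𝔪⟩ := Ideal.exists_le_maximal _ hne
    haveI : 𝔪.IsPrime := h𝔪.isPrime
    have hmem : PrimeSpectrum.comap (mu₁.toPinf : mu₁.P →+* Pinf f) ⟨𝔪, h𝔪.isPrime⟩ ∈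
        PrimeSpectrum.zeroLocus (J : Set mu₁.P) := by
      rw [PrimeSpectrum.mem_zeroLocus]
      intro j hj
      exact hJ𝔪 (Ideal.mem_map_of_mem _ hj)
    rw [hZ] at hmem
    exact hmem (hC ⟨𝔪, h𝔪.isPrime⟩)
  -- `1 = Σ cᵢ · jᵢ` in `A[x]/(f)`
  have h1mem : (1 : Pinf f) ∈ Submodule.span (Pinf f)
      ((mu₁.toPinf : mu₁.P →+* Pinf f) '' (J : Set mu₁.P)) := by
    have : (1 : Pinf f) ∈ J.map (mu₁.toPinf : mu₁.P →+* Pinf f) := hJtop ▸ Submodule.mem_top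
    exact this
  obtain ⟨N, c, v, hsum⟩ := Submodule.mem_span_set'.mp h1mem
  have hv : ∀ i, ∃ j : mu₁.P, j ∈ J ∧ (mu₁.toPinf : mu₁.P →+* Pinf f) j = v i := fun i =>
    (Set.mem_image _ _ _).mp (v i).2
  choose j hjJ hjv using hv
  -- Step 5: lift the `cᵢ` to a level `μ₂ ≥ μ₁`, and kill the relation at a level `μ₃ ≥ μ₂`
  obtain ⟨mu₂, h₁₂, c', hc'⟩ := exists_level_forall_toPinf_eq mu₁ c
  letI i₁₂ := algebraOfLE h₁₂
  haveI := isScalarTower_of_le h₁₂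
  let e : mu₂.P := ∑ i, c' i * (incl : mu₁.P →ₐ[mu₁.T] mu₂.P) (j i) - 1
  have he : mu₂.toPinf e = 0 := by
    simp only [e, map_sub, map_sum, map_mul, map_one, toPinf_incl, hc']
    rw [sub_eq_zero, ← hsum]
    exact Finset.sum_congr rfl fun i _ => by rw [smul_eq_mul, ← hjv i]; rfl
  obtain ⟨mu₃, h₂₃, he₃⟩ := exists_incl_eq_zero mu₂ e he
  letI i₂₃ := algebraOfLE h₂₃
  haveI := isScalarTower_of_le h₂₃
  letI i₁₃ := algebraOfLE (h₁₂.trans h₂₃)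
  haveI := isScalarTower_of_le (h₁₂.trans h₂₃)
  haveI : IsScalarTower mu₁.T mu₂.T mu₃.T := IsScalarTower.of_algebraMap_eq fun _ => rfl
  have hrel : ∑ i, (incl : mu₂.P →ₐ[mu₂.T] mu₃.P) (c' i) *
      (incl : mu₁.P →ₐ[mu₁.T] mu₃.P) (j i) = 1 := by
    have h := he₃
    simp only [e, map_sub, map_sum, map_mul, map_one, incl_incl, sub_eq_zero] at h
    exact h
  -- Step 6: every prime of `P_{μ₃}` lies over `U_{μ₁}`, hence is flat
  refine ⟨mu₃, ?_⟩
  have hprime : ∀ (Q₃ : Ideal mu₃.P) [Q₃.IsPrime], Module.Flat mu₃.T (Localization.AtPrime Q₃) := by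
    intro Q₃ _
    let Q₁ : Ideal mu₁.P := Q₃.comap (incl : mu₁.P →ₐ[mu₁.T] mu₃.P)
    haveI : Q₁.IsPrime := Ideal.IsPrime.comap _
    have hQ₁ : (⟨Q₁, inferInstance⟩ : PrimeSpectrum mu₁.P) ∈ U mu₁ := by
      by_contra hnot
      have hZ' : (⟨Q₁, inferInstance⟩ : PrimeSpectrum mu₁.P) ∈ PrimeSpectrum.zeroLocus (J : Set mu₁.P) := by
        rw [hZ]; exact hnot
      rw [PrimeSpectrum.mem_zeroLocus] at hZ'
      have hjQ : ∀ i, (incl : mu₁.P →ₐ[mu₁.T] mu₃.P) (j i) ∈ Q₃ := fun i =>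
        Ideal.mem_comap.mp (hZ' (hjJ i))
      apply (inferInstance : Q₃.IsPrime).ne_top
      rw [Ideal.eq_top_iff_one, ← hrel]
      exact Q₃.sum_mem fun i _ => Q₃.mul_mem_left _ (hjQ i)
    exact flat_localization_of_le Q₁ Q₃ rfl hQ₁
  -- Step 7: flatness is local on the maximal ideals of `P_{μ₃}`
  haveI : ∀ (Q : Ideal mu₃.P) [Q.IsMaximal], IsLocalizedModule.AtPrime Q
      ((IsScalarTower.toAlgHom mu₃.P mu₃.P (Localization.AtPrime Q)).toLinearMap) :=
    fun Q _ => isLocalizedModule_iff_isLocalization.mpr inferInstance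
  exact Module.flat_of_isLocalized_maximal (R := mu₃.T) (S := mu₃.P) mu₃.P
    (fun Q _ => Localization.AtPrime Q)
    (fun Q _ => (IsScalarTower.toAlgHom mu₃.P mu₃.P (Localization.AtPrime Q)).toLinearMap)
    (fun Q _ => hprime Q)

end Idx

end Literature.RingTheory.Flat

end
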